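import Literature.Combinatorics.SimpleGraph.MaximumParkingFunctionsTrees
import Literature.Combinatorics.SimpleGraph.GraphAbelJacobi
import HarnessLib

/-!
# The Jacobian of a connected graph is trivial iff the graph is a tree; equivalently all
# vertex divisors `(v)` are linearly equivalent (Benson–Chakrabarty–Tetali 2010, Theorem 3.4 /
# Corollary 3.6 through `|Jac(G)| = |𝒫(G,q)| = t(G)`; Baker–Norine 2007, Lemma 4.6 for trees)

Sources (held, read at the page; statements VERBATIM). B. Benson, D. Chakrabarty, P. Tetali
[BensonChakrabartyTetali2010] (held `paper:arxiv-0801.1114`, chunk p0007): «**Theorem 3.4.**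
Let `G` be a simple, connected graph. Then, for a fixed choice of `q`, `G` has a unique maximum
`G`-parking function if and only if `G` is a tree. […] **Corollary 3.6.** For every `G`,
`|𝒫(G,q)| = 1` if and only if `|MP(G,q)| = 1`.» M. Baker, S. Norine [BakerNorine2007] (held
`paper:doi-10-1016-j-aim-2007-04-012`, p0019–p0020), §4.3–§4.4: «if an edge `e₀` of `G` is not
contained in any cycle, then letting `v, v′` denote the endpoints of `e₀`, […] `S_{v₀}(v) = S_{v₀}(v′)`
[…] **Lemma 4.6.** `ρ(v₁) = ρ(v₂)` if and only if `(v₁) ∼ (v₂)`.» (On a tree every edge is a bridge, so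
all `(v)` are equivalent.) The order of the Jacobian is the number of spanning trees (the tree's
`ChipFiring.card_criticalGroup`, Godsil–Royle §14.13), and `|𝒫(G,q)| = t(G)`
(`card_isReduced_apply_base_eq_card_spanningTrees`).

## What is formalised (vocabulary: lineage `criticalGroup G` (= Jac(G) = Div⁰/Prin), `LinEquiv`,
## `IsReduced`)

* **`card_criticalGroup_eq_one_iff_isTree`** — `|Jac(G)| = 1 ⟺ G` is a tree (connected `G`);
* `linEquiv_of_forall_linEquiv_single` — if all `(v) ∼ (w)` then any two divisors of equal degree
  are equivalent; **`forall_linEquiv_single_iff_isTree`** — all `(v) ∼ (w)` iff `G` is a tree;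
  `subsingleton_criticalGroup_iff_isTree`.

Theorems only; no `sorry`; no named facts.
-/

open Finset SimpleGraph
open Literature.Combinatorics.SimpleGraph.ChipFiring

namespace Literature.Combinatorics.SimpleGraph.BakerNorine

variable {V : Type*} [Fintype V] [DecidableEq V] {G : SimpleGraph V} [DecidableRel G.Adj]

/-- **The Jacobian of a connected graph is trivial iff the graph is a tree**:
`|Jac(G)| = t(G) = |𝒫(G,q)|`, and `|𝒫(G,q)| = 1` iff `G` is a tree (Theorem 3.4 / Corollary 3.6).
[cite: BensonChakrabartyTetali2010, Theorem 3.4 (with Corollary 3.6)]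
[cite: GodsilRoyle2001, §14.13 (order of the critical group = number of spanning trees)] -/
theorem card_criticalGroup_eq_one_iff_isTree (hG : G.Connected) :
    Nat.card (criticalGroup G) = 1 ↔ G.IsTree := by
  obtain ⟨q⟩ := hG.nonempty
  rw [card_criticalGroup G hG, ← card_isReduced_apply_base_eq_card_spanningTrees hG q (-1),
    card_parking_eq_one_iff_isTree hG q]

/-- If all vertex divisors are linearly equivalent, then any two divisors of the same degree are:
`D − D′ = Σ_v (D − D′)(v) · ((v) − (v₀)) ∈ Prin(G)`. [cite: BakerNorine2007, §4.3–§4.4 (Lemma 4.6)] -/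
theorem linEquiv_of_forall_linEquiv_single [Nonempty V]
    (h : ∀ v w : V, LinEquiv G (Pi.single v 1) (Pi.single w 1)) {D D' : V → ℤ}
    (hdeg : ∑ v, D v = ∑ v, D' v) : LinEquiv G D D' := by
  obtain ⟨v₀⟩ := ‹Nonempty V›
  rw [linEquiv_iff]
  set E := D - D' with hE
  have hsum : ∑ v, E v = 0 := by
    simp only [hE, Pi.sub_apply, Finset.sum_sub_distrib, hdeg, sub_self]
  -- `E = Σ_v E(v) • ((v) − (v₀))`
  have hdecomp : E = ∑ v, E v • (Pi.single v (1 : ℤ) - Pi.single v₀ 1) := by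
    have h1 : ∑ v, E v • (Pi.single v (1 : ℤ) - Pi.single v₀ 1) =
        ∑ v, Pi.single v (E v) - (∑ v, E v) • Pi.single v₀ (1 : ℤ) := by
      rw [Finset.sum_smul, ← Finset.sum_sub_distrib]
      refine Finset.sum_congr rfl fun v _ => ?_
      rw [smul_sub]
      congr 1
      ext w
      simp only [Pi.smul_apply, Pi.single_apply, smul_eq_mul, mul_ite, mul_one, mul_zero]
    rw [h1, hsum, zero_smul, sub_zero, Finset.univ_sum_single]
  rw [hdecomp]
  exact AddSubgroup.sum_mem _ fun v _ => AddSubgroup.zsmul_mem _ ((linEquiv_iff G _ _).1 (h v v₀)) _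

/-- **All vertex divisors `(v)` are linearly equivalent iff `G` is a tree** (connected `G`): on a
tree every edge is a bridge, so `(v) ∼ (v′)` across each edge; conversely `Jac(G)` is then
trivial, which forces a tree. [cite: BakerNorine2007, §4.3–§4.4 (Lemma 4.6)]
[cite: BensonChakrabartyTetali2010, Theorem 3.4 (with Corollary 3.6)] -/
theorem forall_linEquiv_single_iff_isTree (hG : G.Connected) :
    (∀ v w : V, LinEquiv G (Pi.single v 1) (Pi.single w 1)) ↔ G.IsTree := by
  haveI : Nonempty V := hG.nonempty
  refine ⟨fun h => ?_, fun hT v w => linEquiv_of_isTree hT (by simp)⟩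
  rw [← card_criticalGroup_eq_one_iff_isTree hG, Nat.card_eq_one_iff_unique]
  refine ⟨⟨fun a b => ?_⟩, ⟨0⟩⟩
  induction a using QuotientAddGroup.induction_on with
  | H F =>
    induction b using QuotientAddGroup.induction_on with
    | H F' =>
      rw [mk_eq_mk_iff_linEquiv]
      exact linEquiv_of_forall_linEquiv_single h
        (((mem_zeroSumLattice_iff _).1 F.2).trans ((mem_zeroSumLattice_iff _).1 F'.2).symm)

/-- Equivalently: `Jac(G)` has one element (is a subsingleton) iff `G` is a tree.
[cite: BensonChakrabartyTetali2010, Theorem 3.4 (with Corollary 3.6)] -/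
theorem subsingleton_criticalGroup_iff_isTree (hG : G.Connected) :
    Subsingleton (criticalGroup G) ↔ G.IsTree := by
  rw [← card_criticalGroup_eq_one_iff_isTree hG, Nat.card_eq_one_iff_unique]
  exact ⟨fun h => ⟨h, ⟨0⟩⟩, fun h => h.1⟩

end Literature.Combinatorics.SimpleGraph.BakerNorine
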